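import Literature.NumberTheory.LFunctions.Zhang2022.KnifeEdgeWallCross
import Literature.NumberTheory.LFunctions.Zhang2022.RepairWallBand

/-!
# Zhang (2022), programme F-S3 §E (cell landau-siegel, barrier extension, seat p3): the cross slot of the wall/band
# family is FORCED by the dictionary — in any (A)-world where the three wall/band dictionary rows hold, the
# model-level Cauchy–Schwarz `|X(u,W)|² ≤ 𝔅(u)·|h⁺|²K[b]` is a consequence of the discrete one, or (A) fails

Y. Zhang, *Discrete mean estimates and the Landau–Siegel zero*, arXiv:2211.02515v1 [Zhang2022LandauSiegel] —
an unrefereed manuscript under adjudication. **WHAT THIS IS NOT: not a claim about Theorems 1–2 of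
arXiv:2211.02515, about Landau–Siegel zeros, about a repaired `Margin232`, or about Parity; nothing here asserts any
claim of the manuscript or any estimate. The programme SEARCHES and TYPES; no claim until a kernel theorem says so.**
Companion of `RepairWallBand` (p459421, `KnifeEdge.familyWallBand`: B-multi's sub-class M3 decided in the MODEL
currency under the displayed slots `K ≥ 0` (E-005/E-034) and `WallCrossCS K X` (E-006)) and of
`KnifeEdgeWallCross` (p459102, ls-Bmulti-typer-1: the polar discrete pairing `KnifeEdge.discPolar`, the weighted
discrete Cauchy–Schwarz `KnifeEdge.norm_sq_discPolar_le` — a THEOREM at every modulus under weights `≥ 0` —, the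
cross row `KnifeEdge.ECrossBandAsymp c' Λ X` (E-006's (A)-world asymptotic with slot `X`), and the one-modulus
ε-inequality `KnifeEdge.eCrossBandAsymp_cs`).

**Where the slot comes from.** `familyWallBand`'s verdict displays `WallCrossCS K X` («`|X(u,W)|² ≤ 𝔅(u)·|h⁺|²K[b]`
for every design», registry E-006 in its (B1) form) as a hypothesis on the world `(K, X)`. It is not free-floating:
split the discrete mean of a realised wall design into bulk + band + `2Re` cross (`discMean_wallDesign`); IF under (A)
the three pieces have main terms `𝔅(u)·𝔞𝔓` (bulk row, `BulkAsympAt` — Prop 7.1's (7.2) for the in-class piece),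
`|h⁺|²K[b]·𝔞𝔓` (band row, `BandAsympAt` — E-034 split off) and `X(u,W)·𝔞𝔓` (cross row, `CrossAsympAt` ⇐
`ECrossBandAsymp`, E-006), THEN the discrete Cauchy–Schwarz passes to the limit: **at any design where the model
cross beats its own Cauchy–Schwarz maximum, `𝔅(u)·|h⁺|²K[b] < |X(u,W)|²` (in ANY phase — not only a negative
cross), (A) fails for every real primitive character to every large modulus**
(`eventually_not_assumptionA_of_cross_beyond_cs`), hence Theorem 1 of the manuscript by its own Part-1 endgame
(`theorem1_of_cross_beyond_cs`, `Skeleton.theorem1_of_eventually_not_assumptionA`). Contrapositive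
(`wallCross_cs_of_dictionary`, `wallCrossCS_of_dictionary`): in a world whose dictionary rows hold and in which (A)
is not eventually false, the model slot `WallCrossCS K X` HOLDS — E-006 is «(B1)-excluded at main order» as a kernel
implication, not only as a price tag (registry E-035 wording). The ε-algebra: the rows at accuracy `ε` give
`(|X| − ε)² ≤ (𝔅 + ε)(V + ε)` (`eCrossBandAsymp_cs`), i.e. `|X|² − 𝔅V ≤ ε(𝔅 + V + 2|X|)` — linear in `ε`, so a
positive gap `|X|² − 𝔅V` is contradicted at `ε = min(|X|/2, gap/(2(𝔅 + V + 2|X| + 1)))`.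

**What is displayed (C3).** The three rows are bare `Prop`s with parameters (`BulkAsympAt c' u u'`,
`BandAsympAt c' K Λ W`, `CrossAsympAt c' Λ X u u' W`) — DICTIONARY claims of the cell (status derivation /
HEURISTIC for the band and cross rows, E-034/E-006; the bulk row is the manuscript's Prop 7.1 on its own class),
NOT asserted; `Prop22i` and `Lemma23 c'` are the manuscript's CLAIMS that make the weights `≥ 0`. Nothing numeric.

**For the family (Part 3).** `familyWallBand_of_dictionary`: with the split dictionary in hand the verdict of
`familyWallBand` needs only `K ≥ 0` and «(A) not eventually false» — the DICHOTOMY `familyWallBand_dichotomy`: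
either (A) fails for all large `D` (and then Theorem 1), or no wall/band design has a negative model constant.

Deliberately NOT here: any derivation of the rows; interior jumps / Λ-block; certificates (none). Axioms standard.
References: Zhang, arXiv:2211.02515v1, §2 Lemma 2.3, Prop. 2.2 (i), (2.15)–(2.17), §7 Prop 7.1 (7.2), §8 Lemma 8.1
[cite: Zhang2022LandauSiegel, §2 Lemma 2.3, (2.15)–(2.17); §7 Prop 7.1 (7.2); §8 Lemma 8.1]; cell files
barrier/ASSIGNMENTS.md (S-E-p3-3 follow-up), obj/EDREGISTRY.md rows E-006/E-034/E-035, B-multi/KILL-draft.md §4.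
-/

noncomputable section

open Complex Real Set
open _root_.MeasureTheory

namespace Literature.NumberTheory.LFunctions.Zhang2022

namespace KnifeEdge

open Repair Skeleton

/-! ### Part 1 — the three dictionary rows of a wall/band design, at ONE design (bare `Prop`s, not asserted) -/

/-- **Bulk row at `(u, u′)`** (Prop 7.1 / (7.2) for the in-class piece, in the `KnifeEdge.EStarLen` shape): under (A),
the discrete mean of the bulk table `wallBulkPoly χ u` is `𝔅(u)·𝔞𝔓 + o(𝔞𝔓)`. A dictionary claim, NOT asserted.
[cite: Zhang2022LandauSiegel, §7 Prop 7.1 (7.2), §8 (8.3)] -/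
def BulkAsympAt (c' : ℝ) (u u' : ℝ → ℂ) : Prop :=
  ∀ ε : ℝ, 0 < ε → ForAllLarge fun D _ χ => AssumptionA D χ →
    |discMean c' χ (wallBulkPoly χ u) - mainTermForm u u' * (frakA χ * frakP D)| ≤ ε * (frakA χ * frakP D)

/-- **Band row at `W`** (registry E-034 split off the joint `EMultiBand`: band functional `K`, scale `Λ`): under (A),
the discrete mean of the band table `wallBandPoly χ Λ W` is `|h⁺|²K[b]·𝔞𝔓 + o(𝔞𝔓)`. Derivation HEURISTIC; NOT asserted.
[cite: Zhang2022LandauSiegel, §2 (2.30), §8 Lemma 8.1] -/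
def BandAsympAt (c' : ℝ) (K : (ℝ → ℂ) → ℝ) (Λ : BandScale) (W : WallData) : Prop :=
  ∀ ε : ℝ, 0 < ε → ForAllLarge fun D _ χ => AssumptionA D χ →
    |discMean c' χ (wallBandPoly χ Λ W) - ‖W.hPlus‖ ^ 2 * K W.band * (frakA χ * frakP D)| ≤ ε * (frakA χ * frakP D)

/-- **Cross row at `(u, W)`** (registry E-006 with slot `X`; `= KnifeEdge.ECrossBandAsymp` at one design,
`crossAsympAt_of_eCrossBandAsymp`): under (A), the polar pairing of the bulk and band tables is `X(u,W)·𝔞𝔓 + o(𝔞𝔓)`.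
NOT asserted. [cite: Zhang2022LandauSiegel, §2 (2.17), §8 Lemma 8.1] -/
def CrossAsympAt (c' : ℝ) (Λ : BandScale) (X : WallCross) (u u' : ℝ → ℂ) (W : WallData) : Prop :=
  ∀ ε : ℝ, 0 < ε → ForAllLarge fun D _ χ => AssumptionA D χ →
    ‖discPolar c' χ (wallBulkPoly χ u) (wallBandPoly χ Λ W) - X u u' W * (frakA χ * frakP D : ℝ)‖
      ≤ ε * (frakA χ * frakP D)

variable {c' : ℝ} {K : (ℝ → ℂ) → ℝ} {Λ : BandScale} {X : WallCross} {u u' : ℝ → ℂ} {W : WallData}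

/-- The typed cross row `ECrossBandAsymp c' Λ X` (p459102) gives the cross row at every kinked design.
[cite: Zhang2022LandauSiegel, §8 Lemma 8.1] -/
theorem crossAsympAt_of_eCrossBandAsymp (h : ECrossBandAsymp c' Λ X) (hu : KinkedProfile u u') (W : WallData) :
    CrossAsympAt c' Λ X u u' W := by
  intro ε hε
  refine (h u u' hu W ε hε).mono fun D _ χ _ _ hD hA => ?_
  have := hD hA
  push_cast at this ⊢
  simpa [mul_assoc] using this

/-! ### Part 2 — the limit: a model cross beyond its Cauchy–Schwarz maximum refutes (A) eventually -/

/-- The ε-algebra: if `0 ≤ a`, `0 ≤ V`, `a·V < x²` (`x ≥ 0`), then at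
`ε = min (x/2) ((x² − aV)/(2(a + V + 2x + 1)))` one has `0 < ε ≤ x` and `(a + ε)(V + ε) < (x − ε)²`.
Private helper. [folklore] -/
private theorem gap_choice {a V x : ℝ} (ha : 0 ≤ a) (hV : 0 ≤ V) (hx : 0 ≤ x) (hgap : a * V < x ^ 2) :
    ∃ ε : ℝ, 0 < ε ∧ ε ≤ x ∧ (a + ε) * (V + ε) < (x - ε) ^ 2 := by
  have hxpos : 0 < x := by
    rcases eq_or_lt_of_le hx with h | h
    · rw [← h] at hgap; nlinarith
    · exact h
  set g : ℝ := x ^ 2 - a * V with hg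
  have hgpos : 0 < g := by rw [hg]; linarith
  set S : ℝ := a + V + 2 * x + 1 with hS
  have hSpos : 0 < S := by rw [hS]; linarith
  refine ⟨min (x / 2) (g / (2 * S)), lt_min (by linarith) (by positivity), le_trans (min_le_left _ _) (by linarith),
    ?_⟩
  set ε : ℝ := min (x / 2) (g / (2 * S)) with hε
  have hε1 : ε ≤ g / (2 * S) := min_le_right _ _
  have hε0 : 0 ≤ ε := le_min (by linarith) (by positivity)
  have hεS : ε * S ≤ g / 2 := by
    have := mul_le_mul_of_nonneg_right hε1 hSpos.le
    calc ε * S ≤ g / (2 * S) * S := this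
      _ = g / 2 := by field_simp
  -- `(a+ε)(V+ε) − (x−ε)² = (aV − x²) + ε(a + V + 2x) = −g + ε(S − 1)`
  have key : (a + ε) * (V + ε) - (x - ε) ^ 2 = -g + ε * (S - 1) := by rw [hg, hS]; ring
  nlinarith

/-- **A model cross beyond its Cauchy–Schwarz maximum refutes (A), eventually.** If at one wall/band design `(u, W)`
(`u` kinked, band block `|h⁺|²K[b] ≥ 0`) the three dictionary rows hold with constants `𝔅(u)`, `|h⁺|²K[b]`,
`X(u,W)`, and the model cross violates subordination — `𝔅(u)·|h⁺|²K[b] < |X(u,W)|²`, in ANY phase — then, granted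
the manuscript's Prop. 2.2 (i) and Lemma 2.3 (weights `≥ 0`), (A) fails for every real primitive character to every
large modulus: at a modulus where (A) held, the rows at a small accuracy `ε` and the discrete Cauchy–Schwarz
(`eCrossBandAsymp_cs`) would give `(|X| − ε)² ≤ (𝔅 + ε)(V + ε)`, contradicting the gap (`gap_choice`).
[cite: Zhang2022LandauSiegel, §2 Lemma 2.3, Prop. 2.2 (i), (2.15)–(2.17); §8 Lemma 8.1] -/
theorem eventually_not_assumptionA_of_cross_beyond_cs (hB : BulkAsympAt c' u u') (hV : BandAsympAt c' K Λ W)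
    (hX : CrossAsympAt c' Λ X u u' W) (hu : KinkedProfile u u') (hK : 0 ≤ K W.band)
    (hgap : mainTermForm u u' * (‖W.hPlus‖ ^ 2 * K W.band) < ‖X u u' W‖ ^ 2)
    (h22 : Prop22i) (h23 : Lemma23 c') :
    ∃ D₀ : ℕ, ∀ (D : ℕ) [NeZero D] (χ : DirichletCharacter ℂ D),
      D₀ ≤ D → χ.IsQuadratic → χ.IsPrimitive → ¬ AssumptionA D χ := by
  set a : ℝ := mainTermForm u u' with ha
  set V : ℝ := ‖W.hPlus‖ ^ 2 * K W.band with hVdef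
  set x : ℝ := ‖X u u' W‖ with hx
  have ha0 : 0 ≤ a := mainTermForm_nonneg_of_isH1 hu.isH1
  have hV0 : 0 ≤ V := mul_nonneg (sq_nonneg _) hK
  obtain ⟨ε, hε, hεx, hlt⟩ := gap_choice ha0 hV0 (norm_nonneg _) hgap
  obtain ⟨D₁, h₁⟩ := ((((hB ε hε).and (hV ε hε)).and (hX ε hε)).and h22).and h23
  obtain ⟨a₀, ha₀, D₂, h₂⟩ := frakALowerBound_holds
  obtain ⟨D₃, h₃⟩ := frakP_eventually_pos
  refine ⟨max (max D₁ D₂) (max D₃ 3), fun D _ χ hD hq hp hA => ?_⟩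
  have hD₁ : D₁ ≤ D := le_trans (le_trans (le_max_left _ _) (le_max_left _ _)) hD
  have hD₂ : D₂ ≤ D := le_trans (le_trans (le_max_right _ _) (le_max_left _ _)) hD
  have hD₃ : D₃ ≤ D := le_trans (le_trans (le_max_left _ _) (le_max_right _ _)) hD
  have hD3 : 3 ≤ D := le_trans (le_trans (le_max_right _ _) (le_max_right _ _)) hD
  obtain ⟨⟨⟨⟨hbulk, hband⟩, hcross⟩, h22'⟩, h23'⟩ := h₁ D χ hD₁ hq hp
  have hA0 : 0 < frakA χ := lt_of_lt_of_le ha₀ (h₂ D χ hD₂ hq hp hA)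
  have hP0 : 0 < frakP D := h₃ D hD₃
  have hN : 0 < frakA χ * frakP D := mul_pos hA0 hP0
  have hw := weights_nonneg_of hD3 h23' h22'
  have hF := hbulk hA
  have hG := hband hA
  have hXX := hcross hA
  have key := eCrossBandAsymp_cs (c' := c') (χ := χ) (𝔅 := a) (V := V) (Xv := X u u' W) hN hw hF hG
    (by exact_mod_cast hXX) hεx
  exact absurd key (not_le.2 hlt)

/-- **… hence Theorem 1 of the manuscript**, by its own Part-1 endgame
(`Skeleton.theorem1_of_eventually_not_assumptionA`): with the split dictionary at one design, a model cross beyond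
its Cauchy–Schwarz maximum is already a proof of Theorem 1 — no negative constant is needed.
[cite: Zhang2022LandauSiegel, §1 Theorem 1; §2 Lemma 2.3, Prop. 2.2 (i)] -/
theorem theorem1_of_cross_beyond_cs (hB : BulkAsympAt c' u u') (hV : BandAsympAt c' K Λ W)
    (hX : CrossAsympAt c' Λ X u u' W) (hu : KinkedProfile u u') (hK : 0 ≤ K W.band)
    (hgap : mainTermForm u u' * (‖W.hPlus‖ ^ 2 * K W.band) < ‖X u u' W‖ ^ 2)
    (h22 : Prop22i) (h23 : Lemma23 c') : Theorem1 :=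
  Skeleton.theorem1_of_eventually_not_assumptionA
    (eventually_not_assumptionA_of_cross_beyond_cs hB hV hX hu hK hgap h22 h23)

/-- **The slot is FORCED at a design** (contrapositive): if the three rows hold at `(u, W)`, `|h⁺|²K[b] ≥ 0`, the
weights are `≥ 0` (Prop. 2.2 (i), Lemma 2.3), and (A) is NOT eventually false, then the model cross IS subordinate
there: `|X(u,W)|² ≤ 𝔅(u)·|h⁺|²K[b]`. [cite: Zhang2022LandauSiegel, §2 Lemma 2.3, (2.15)–(2.17); §8 Lemma 8.1] -/
theorem wallCross_cs_of_dictionary (hB : BulkAsympAt c' u u') (hV : BandAsympAt c' K Λ W)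
    (hX : CrossAsympAt c' Λ X u u' W) (hu : KinkedProfile u u') (hK : 0 ≤ K W.band)
    (h22 : Prop22i) (h23 : Lemma23 c')
    (hA : ¬ ∃ D₀ : ℕ, ∀ (D : ℕ) [NeZero D] (χ : DirichletCharacter ℂ D),
      D₀ ≤ D → χ.IsQuadratic → χ.IsPrimitive → ¬ AssumptionA D χ) :
    ‖X u u' W‖ ^ 2 ≤ mainTermForm u u' * (‖W.hPlus‖ ^ 2 * K W.band) := by
  by_contra hcon
  push Not at hcon
  exact hA (eventually_not_assumptionA_of_cross_beyond_cs hB hV hX hu hK hcon h22 h23)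

/-- **The class slot `WallCrossCS K X` is FORCED by the dictionary**: if the bulk row holds at every kinked piece,
the band row at every band datum, the cross row is the typed `ECrossBandAsymp c' Λ X`, `K ≥ 0`, the weights are
`≥ 0`, and (A) is not eventually false, then `WallCrossCS K X` — the displayed E-006 slot of `familyWallBand` —
HOLDS. [cite: Zhang2022LandauSiegel, §2 Lemma 2.3, (2.15)–(2.17); §8 Lemma 8.1] -/
theorem wallCrossCS_of_dictionary (hB : ∀ u u' : ℝ → ℂ, KinkedProfile u u' → BulkAsympAt c' u u')
    (hV : ∀ W : WallData, BandAsympAt c' K Λ W) (hX : ECrossBandAsymp c' Λ X) (hK : ∀ b : ℝ → ℂ, 0 ≤ K b)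
    (h22 : Prop22i) (h23 : Lemma23 c')
    (hA : ¬ ∃ D₀ : ℕ, ∀ (D : ℕ) [NeZero D] (χ : DirichletCharacter ℂ D),
      D₀ ≤ D → χ.IsQuadratic → χ.IsPrimitive → ¬ AssumptionA D χ) :
    WallCrossCS K X :=
  fun u u' W hu => wallCross_cs_of_dictionary (hB u u' hu) (hV W) (crossAsympAt_of_eCrossBandAsymp hX hu W) hu
    (hK _) h22 h23 hA

/-! ### Part 3 — the wall/band family under the dictionary: the DICHOTOMY -/

/-- **DICHOTOMY for B-multi's M3 under the split dictionary.** Granted the bulk/band/cross rows, `K ≥ 0` and the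
manuscript's Prop. 2.2 (i) / Lemma 2.3: EITHER (A) fails for every real primitive character to every large modulus
(and then Theorem 1, `Skeleton.theorem1_of_eventually_not_assumptionA`), OR no wall/band design has a negative model
constant (`¬ EMultiBandCloses K X`). The cross slot of `familyWallBand` has been absorbed into the dictionary.
[cite: Zhang2022LandauSiegel, §2 Lemma 2.3, Prop. 2.2 (i); §7 Prop 7.1 (7.2); §8 Lemma 8.1] -/
theorem familyWallBand_dichotomy (hB : ∀ u u' : ℝ → ℂ, KinkedProfile u u' → BulkAsympAt c' u u')
    (hV : ∀ W : WallData, BandAsympAt c' K Λ W) (hX : ECrossBandAsymp c' Λ X) (hK : ∀ b : ℝ → ℂ, 0 ≤ K b)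
    (h22 : Prop22i) (h23 : Lemma23 c') :
    (∃ D₀ : ℕ, ∀ (D : ℕ) [NeZero D] (χ : DirichletCharacter ℂ D),
        D₀ ≤ D → χ.IsQuadratic → χ.IsPrimitive → ¬ AssumptionA D χ)
      ∨ ¬ EMultiBandCloses K X := by
  by_cases hA : ∃ D₀ : ℕ, ∀ (D : ℕ) [NeZero D] (χ : DirichletCharacter ℂ D),
      D₀ ≤ D → χ.IsQuadratic → χ.IsPrimitive → ¬ AssumptionA D χ
  · exact Or.inl hA
  · exact Or.inr (not_eMultiBandCloses_of_cs hK (wallCrossCS_of_dictionary hB hV hX hK h22 h23 hA))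

/-- **The family verdict from the dictionary** (no displayed cross slot): under the split rows, `K ≥ 0`, Prop. 2.2 (i),
Lemma 2.3 and «(A) not eventually false», every member of `familyWallBand` satisfies its verdict's conclusion for this
world. [cite: Zhang2022LandauSiegel, §2 Lemma 2.3; §7 Prop 7.1 (7.2); §8 Lemma 8.1] -/
theorem familyWallBand_of_dictionary (hB : ∀ u u' : ℝ → ℂ, KinkedProfile u u' → BulkAsympAt c' u u')
    (hV : ∀ W : WallData, BandAsympAt c' K Λ W) (hX : ECrossBandAsymp c' Λ X) (hK : ∀ b : ℝ → ℂ, 0 ≤ K b)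
    (h22 : Prop22i) (h23 : Lemma23 c')
    (hA : ¬ ∃ D₀ : ℕ, ∀ (D : ℕ) [NeZero D] (χ : DirichletCharacter ℂ D),
      D₀ ≤ D → χ.IsQuadratic → χ.IsPrimitive → ¬ AssumptionA D χ)
    (hu : KinkedProfile u u') (W : WallData) : ¬ (wallMainTerm K X u u' W < 0) :=
  not_lt.2 (wallMainTerm_nonneg_of_cs hK (wallCrossCS_of_dictionary hB hV hX hK h22 h23 hA) hu W)

/-- **… and a closing wall design under the dictionary IS Theorem 1** (the model-currency twin of p459102's
`theorem1_of_crossNegDiscrete`; here any `EMultiBandCloses K X` suffices, no saturation or `κ > 2` bookkeeping).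
[cite: Zhang2022LandauSiegel, §1 Theorem 1; §2 Lemma 2.3, Prop. 2.2 (i)] -/
theorem theorem1_of_eMultiBandCloses_of_dictionary (hB : ∀ u u' : ℝ → ℂ, KinkedProfile u u' → BulkAsympAt c' u u')
    (hV : ∀ W : WallData, BandAsympAt c' K Λ W) (hX : ECrossBandAsymp c' Λ X) (hK : ∀ b : ℝ → ℂ, 0 ≤ K b)
    (h22 : Prop22i) (h23 : Lemma23 c') (hC : EMultiBandCloses K X) : Theorem1 := by
  rcases familyWallBand_dichotomy hB hV hX hK h22 h23 with hA | hno
  · exact Skeleton.theorem1_of_eventually_not_assumptionA hA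
  · exact absurd hC hno

end KnifeEdge

end Literature.NumberTheory.LFunctions.Zhang2022
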